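import Mathlib
import Summits.Ventures.PercRepro2.SixTypedAbstract

set_option Elab.async false

/-!
# Six typed edges, VIII.20: the kernel groups of the prefixes `234` … `252` (blind cell PercRepro2, night-3,
2026-08-25)

`shard6` on 19 of the 252 guarded canonical prefixes, by `decide +kernel`; the prefixes with many leaves
are sliced by `a9` (`shard6a`) and, where needed, by `a10` (`shard6b`) and re-assembled by `interval_cases`.
(File 20 of 20: g7's twelve files re-cut at whole-subtree boundaries to the 400-line limit, g8.)
-/

namespace Summit.Ventures.PercRepro2

open UnionCluster

namespace CovForm

namespace TwoTyped

open OneTyped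

section Shards6

set_option maxHeartbeats 0 in
/-- kernel group `sh_234` -/
theorem sh_234 : shard6 1 2 3 4 2 6 3 8 = true := by
  decide +kernel

set_option maxHeartbeats 0 in
/-- kernel group `sh_235` -/
theorem sh_235 : shard6 1 2 3 4 2 6 4 6 = true := by
  decide +kernel

set_option maxHeartbeats 0 in
/-- kernel group `sh_236` -/
theorem sh_236 : shard6 1 2 3 4 2 6 4 8 = true := by
  decide +kernel

set_option maxHeartbeats 0 in
/-- kernel group `sh_237` -/
theorem sh_237 : shard6 1 2 3 4 2 6 6 8 = true := by
  decide +kernel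

set_option maxHeartbeats 0 in
/-- kernel group `sh_238` -/
theorem sh_238 : shard6 1 2 3 4 2 6 7 8 = true := by
  decide +kernel

set_option maxHeartbeats 0 in
/-- kernel group `sh_239` -/
theorem sh_239 : shard6 1 2 3 4 3 4 3 8 = true := by
  decide +kernel

set_option maxHeartbeats 0 in
/-- kernel group `sh_240` -/
theorem sh_240 : shard6 1 2 3 4 3 4 4 8 = true := by
  decide +kernel

set_option maxHeartbeats 0 in
/-- kernel group `sh_241` -/
theorem sh_241 : shard6 1 2 3 4 3 4 7 8 = true := by
  decide +kernel

set_option maxHeartbeats 0 in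
/-- kernel group `sh_242` -/
theorem sh_242 : shard6 1 2 3 4 3 6 3 8 = true := by
  decide +kernel

set_option maxHeartbeats 0 in
/-- kernel group `sh_243` -/
theorem sh_243 : shard6 1 2 3 4 3 6 4 6 = true := by
  decide +kernel

set_option maxHeartbeats 0 in
/-- kernel group `sh_244` -/
theorem sh_244 : shard6 1 2 3 4 3 6 4 8 = true := by
  decide +kernel

set_option maxHeartbeats 0 in
/-- kernel group `sh_245` -/
theorem sh_245 : shard6 1 2 3 4 3 6 6 8 = true := by
  decide +kernel

set_option maxHeartbeats 0 in
/-- kernel group `sh_246` -/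
theorem sh_246 : shard6 1 2 3 4 3 6 7 8 = true := by
  decide +kernel

set_option maxHeartbeats 0 in
/-- kernel group `sh_247` -/
theorem sh_247 : shard6 1 2 3 4 4 6 4 8 = true := by
  decide +kernel

set_option maxHeartbeats 0 in
/-- kernel group `sh_248` -/
theorem sh_248 : shard6 1 2 3 4 4 6 6 8 = true := by
  decide +kernel

set_option maxHeartbeats 0 in
/-- kernel group `sh_249` -/
theorem sh_249 : shard6 1 2 3 4 4 6 7 8 = true := by
  decide +kernel

set_option maxHeartbeats 0 in
/-- kernel group `sh_250` -/
theorem sh_250 : shard6 1 2 3 4 5 6 5 8 = true := by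
  decide +kernel

set_option maxHeartbeats 0 in
/-- kernel group `sh_251` -/
theorem sh_251 : shard6 1 2 3 4 5 6 6 8 = true := by
  decide +kernel

set_option maxHeartbeats 0 in
/-- kernel group `sh_252` -/
theorem sh_252 : shard6 1 2 3 4 5 6 7 8 = true := by
  decide +kernel

end Shards6

end TwoTyped

end CovForm

end Summit.Ventures.PercRepro2
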